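import Mathlib.MeasureTheory.Measure.WithDensity
import Literature.Probability.LatticeModels.MarkovWindowPeeling
import Literature.Analysis.OperatorTheory.KernelRatioLimit
import Literature.Analysis.OperatorTheory.KernelOverlapContinuity
import HarnessLib

/-!
# Transfer-operator ratios become boundary-independent, uniformly on compact sets of boundary
# spins (`ℝ≥0∞` transfer iterates versus the `L²` transfer operator)

Topic `Literature/Probability/LatticeModels`; theorems only (no definitions, no named facts).
Bridge between the `ℝ≥0∞`/marginal-integral language of one-dimensional nearest-neighbour models
(`MarkovWindowPeeling.lean`, `IntervalBoltzmannTransferForm.lean`: a priori measure `ν` on `S`,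
one-site weight `w : S → ℝ≥0∞`, transfer operator `(T f)(z) = ∫⁻ k(z,y) f(y) w(y) dν(y)`, a
VARIABLE constrained by `hT`) and the real/`L²` language of
`Literature.Analysis.OperatorTheory.KernelRatioLimit` (finite measure `ρ = w · ν`, real kernel
`K` with `k = ENNReal.ofReal ∘ K`, pointwise operator `(κ f)(x) = ∫ K(x,y) f(y) dρ(y)`):

* `lintegral_ofReal_mul_ofReal_mul` — `∫⁻ ofReal(g) ofReal(f) w dν = ofReal(∫ g f dρ)` for
  bounded measurable `f, g ≥ 0`;
* `iterate_transfer_ofReal` — `T^N (ofReal ∘ f) = ofReal ∘ κ^N f`, with `κ^N f ≥ 0` measurable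
  and bounded;
* `iterate_transfer_insertion_eq_ofReal` — the interval quantity
  `T^N [x ↦ ∫⁻ M(x,y) (T^N k(v,·))(y) w(y) dν] (u)` is `ofReal` of the real quantity
  `κ^N [x ↦ ∫ M(x,y).toReal (κ^N K(v,·))(y) dρ] (u) ≥ 0`;
* `exists_limit_iterate_transfer_ratio` (**main**) — for a bounded, symmetric, strictly positive
  kernel continuous in the boundary spin and two bounded insertion kernels `M, M₁` (`M₁ > 0`),
  the ratios `T^N[∫⁻ M …](u) / T^N[∫⁻ M₁ …](u)` converge to a limit `L` as `N → ∞`, UNIFORMLY in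
  the boundary spins `(u, v)` ranging over any compact set (Jentzsch's spectral gap + power
  iteration, `exists_kernelRatio_tendsto_uniformly`, and positivity/continuity of the overlap with
  the Perron–Frobenius eigenfunction, `exists_pos_forall_le_integral_mul_kernel`).

This is the analytic input of uniqueness of the Gibbs state of one-dimensional models with
strictly positive Hilbert–Schmidt transfer operators among states with tight one-site marginals
(Georgii 2011, Thm 10.25, §11.1; Cassandro–Olivieri–Pellegrinotti–Presutti 1978, §2).
[cite: Georgii2011, Thm 10.25 and §11.1]
-/

noncomputable section

open MeasureTheory Set Function Filter Literature.Analysis.OperatorTheory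
open scoped ENNReal

namespace Literature.Probability.LatticeModels

variable {S : Type*} [MeasurableSpace S] {ν : Measure S} {w : S → ℝ≥0∞}

/-! ### `ℝ≥0∞` integrals against `w dν` versus real integrals against `ρ = w · ν` -/

/-- **`∫⁻ ofReal(g) · ofReal(f) · w dν = ofReal (∫ g f dρ)`**, `ρ = ν.withDensity w`, for
measurable, non-negative, bounded `f`, `g` and `∫⁻ w dν < ∞`. [folklore] -/
theorem lintegral_ofReal_mul_ofReal_mul (hw : Measurable w) (hwi : ∫⁻ y, w y ∂ν ≠ ∞)
    {g f : S → ℝ} (hg : Measurable g) (hf : Measurable f) (hg0 : ∀ y, 0 ≤ g y) (hf0 : ∀ y, 0 ≤ f y)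
    {Cg Cf : ℝ} (hgb : ∀ y, g y ≤ Cg) (hfb : ∀ y, f y ≤ Cf) :
    ∫⁻ y, ENNReal.ofReal (g y) * ENNReal.ofReal (f y) * w y ∂ν =
      ENNReal.ofReal (∫ y, g y * f y ∂ν.withDensity w) := by
  haveI : IsFiniteMeasure (ν.withDensity w) := isFiniteMeasure_withDensity hwi
  have h1 : ∀ y, ENNReal.ofReal (g y) * ENNReal.ofReal (f y) * w y =
      w y * ENNReal.ofReal (g y * f y) := fun y => by
    rw [ENNReal.ofReal_mul (hg0 y)]; ring
  simp_rw [h1]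
  have hmeas : Measurable fun y => ENNReal.ofReal (g y * f y) :=
    ENNReal.measurable_ofReal.comp (hg.mul hf)
  have h2 := lintegral_withDensity_eq_lintegral_mul ν hw hmeas
  simp only [Pi.mul_apply] at h2
  rw [← h2]
  have hint : Integrable (fun y => g y * f y) (ν.withDensity w) := by
    refine Integrable.of_bound (hg.mul hf).aestronglyMeasurable (Cg * Cf)
      (Eventually.of_forall fun y => ?_)
    rw [Real.norm_eq_abs, abs_of_nonneg (mul_nonneg (hg0 y) (hf0 y))]
    exact mul_le_mul (hgb y) (hfb y) (hf0 y) ((hg0 y).trans (hgb y))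
  exact (ofReal_integral_eq_lintegral_ofReal hint
    (Eventually.of_forall fun y => mul_nonneg (hg0 y) (hf0 y))).symm

variable {K : S → S → ℝ} {C : ℝ} {k : S → S → ℝ≥0∞} {T : (S → ℝ≥0∞) → (S → ℝ≥0∞)}

/-- **`T^N (ofReal ∘ f) = ofReal ∘ κ^N f`.** For the `ℝ≥0∞` transfer operator
`(T F)(z) = ∫⁻ k(z,y) F(y) w(y) dν` with `k = ofReal ∘ K`, `K ≥ 0` bounded measurable, and the
real operator `(κ f)(x) = ∫ K(x,y) f(y) dρ(y)`, `ρ = w · ν` finite: every iterate `κ^N f` of a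
measurable, non-negative, bounded `f` is measurable, non-negative and bounded, and
`T^N (ofReal ∘ f) = ofReal ∘ κ^N f`. [folklore] -/
theorem iterate_transfer_ofReal [SFinite ν] (hw : Measurable w) (hwi : ∫⁻ y, w y ∂ν ≠ ∞)
    (hK : StronglyMeasurable (uncurry K)) (hC : ∀ x y, ‖K x y‖ ≤ C) (hK0 : ∀ x y, 0 ≤ K x y)
    (hk : ∀ x y, k x y = ENNReal.ofReal (K x y))
    (hT : ∀ f z, T f z = ∫⁻ y, k z y * f y * w y ∂ν)
    {f : S → ℝ} (hf : Measurable f) (hf0 : ∀ y, 0 ≤ f y) {Cf : ℝ} (hfb : ∀ y, f y ≤ Cf) (N : ℕ) :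
    (∃ B : ℝ, ∀ x, ((fun g : S → ℝ => fun x => ∫ y, K x y * g y ∂ν.withDensity w)^[N] f) x ≤ B) ∧
      Measurable ((fun g : S → ℝ => fun x => ∫ y, K x y * g y ∂ν.withDensity w)^[N] f) ∧
      (∀ x, 0 ≤ ((fun g : S → ℝ => fun x => ∫ y, K x y * g y ∂ν.withDensity w)^[N] f) x) ∧
      T^[N] (fun y => ENNReal.ofReal (f y)) =
        fun x => ENNReal.ofReal (((fun g : S → ℝ => fun x => ∫ y, K x y * g y ∂ν.withDensity w)^[N] f) x) := by
  haveI : IsFiniteMeasure (ν.withDensity w) := isFiniteMeasure_withDensity hwi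
  set κ : (S → ℝ) → S → ℝ := fun g x => ∫ y, K x y * g y ∂ν.withDensity w with hκ
  induction N with
  | zero =>
    exact ⟨⟨Cf, fun x => by simpa using hfb x⟩, by simpa using hf, fun x => by simpa using hf0 x,
      by simp⟩
  | succ N ih =>
    obtain ⟨⟨B, hB⟩, hm, h0, heq⟩ := ih
    set g : S → ℝ := κ^[N] f with hg
    have hsucc : κ^[N + 1] f = κ g := by rw [Function.iterate_succ_apply', ← hg]
    -- measurability and bound of the next iterate from the tree's bridge lemma
    obtain ⟨⟨B', hB'⟩, hsm⟩ := exists_bound_and_measurable_kernelIterate (μ := ν.withDensity w)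
      hK hC hf ⟨max Cf 0, fun y => by
        rw [Real.norm_eq_abs, abs_of_nonneg (hf0 y)]; exact (hfb y).trans (le_max_left _ _)⟩ (N + 1)
    have hnonneg : ∀ x, 0 ≤ (κ g) x := fun x =>
      integral_nonneg fun y => mul_nonneg (hK0 x y) (h0 y)
    refine ⟨⟨B', fun x => (le_abs_self _).trans ((Real.norm_eq_abs _).symm.le.trans (hB' x))⟩,
      hsm.measurable, fun x => by rw [hsucc]; exact hnonneg x, ?_⟩
    rw [Function.iterate_succ_apply', heq, hsucc]
    funext x
    rw [hT]
    have hKx : Measurable (K x) := hK.measurable.of_uncurry_left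
    have h1 : ∀ y, k x y * ENNReal.ofReal (g y) * w y =
        ENNReal.ofReal (K x y) * ENNReal.ofReal (g y) * w y := fun y => by rw [hk]
    simp_rw [h1]
    exact lintegral_ofReal_mul_ofReal_mul hw hwi hKx hm (hK0 x) h0
      (fun y => (le_abs_self _).trans ((Real.norm_eq_abs _).symm.le.trans (hC x y))) hB

/-- **The interval quantity is `ofReal` of the real transfer-operator quantity.** With the data of
`iterate_transfer_ofReal` and a jointly measurable insertion kernel `M ≤ ofReal C_M`, for all
`N, u, v`:
`T^N [x ↦ ∫⁻ M(x,y) (T^N k(v,·))(y) w(y) dν(y)] (u) = ofReal (κ^N [x ↦ ∫ M(x,y).toReal (κ^N K(v,·))(y) dρ(y)] (u))`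
and the real quantity is `≥ 0`. [folklore] -/
theorem iterate_transfer_insertion_eq_ofReal [SFinite ν] (hw : Measurable w)
    (hwi : ∫⁻ y, w y ∂ν ≠ ∞) (hK : StronglyMeasurable (uncurry K)) (hC : ∀ x y, ‖K x y‖ ≤ C)
    (hK0 : ∀ x y, 0 ≤ K x y) (hk : ∀ x y, k x y = ENNReal.ofReal (K x y))
    (hT : ∀ f z, T f z = ∫⁻ y, k z y * f y * w y ∂ν)
    {M : S → S → ℝ≥0∞} {CM : ℝ} (hMm : Measurable (uncurry M)) (hCM : 0 ≤ CM)
    (hMb : ∀ x y, M x y ≤ ENNReal.ofReal CM) (N : ℕ) (u v : S) :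
    (T^[N] fun x => ∫⁻ y, M x y * ((T^[N] (k v)) y * w y) ∂ν) u =
        ENNReal.ofReal (((fun g : S → ℝ => fun x => ∫ y, K x y * g y ∂ν.withDensity w)^[N]
          (fun x => ∫ y, (M x y).toReal *
            ((fun g : S → ℝ => fun x => ∫ y, K x y * g y ∂ν.withDensity w)^[N] (K v)) y
              ∂ν.withDensity w)) u) ∧
      0 ≤ ((fun g : S → ℝ => fun x => ∫ y, K x y * g y ∂ν.withDensity w)^[N]
          (fun x => ∫ y, (M x y).toReal *
            ((fun g : S → ℝ => fun x => ∫ y, K x y * g y ∂ν.withDensity w)^[N] (K v)) y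
              ∂ν.withDensity w)) u := by
  haveI : IsFiniteMeasure (ν.withDensity w) := isFiniteMeasure_withDensity hwi
  set κ : (S → ℝ) → S → ℝ := fun g x => ∫ y, K x y * g y ∂ν.withDensity w with hκ
  have hCb : ∀ x y, K x y ≤ C := fun x y =>
    (le_abs_self _).trans ((Real.norm_eq_abs _).symm.le.trans (hC x y))
  -- the right factor `T^N k(v,·) = ofReal ∘ κ^N K(v,·)`
  have hKv : Measurable (K v) := hK.measurable.of_uncurry_left
  obtain ⟨⟨Bg, hBg⟩, hgm, hg0, hgeq⟩ :=
    iterate_transfer_ofReal hw hwi hK hC hK0 hk hT hKv (hK0 v) (hCb v) N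
  set g : S → ℝ := κ^[N] (K v) with hg
  have hkv : k v = fun y => ENNReal.ofReal (K v y) := funext (hk v)
  -- the insertion integral `H = ofReal ∘ h`
  set m : S → S → ℝ := fun x y => (M x y).toReal with hm
  have hmm : Measurable (uncurry m) := hMm.ennreal_toReal
  have hm0 : ∀ x y, 0 ≤ m x y := fun x y => ENNReal.toReal_nonneg
  have hmb : ∀ x y, m x y ≤ CM := fun x y => ENNReal.toReal_le_of_le_ofReal hCM (hMb x y)
  have hMeq : ∀ x y, M x y = ENNReal.ofReal (m x y) := fun x y =>
    (ENNReal.ofReal_toReal (ne_top_of_le_ne_top ENNReal.ofReal_ne_top (hMb x y))).symm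
  set h : S → ℝ := fun x => ∫ y, m x y * g y ∂ν.withDensity w with hh
  have hH : (fun x => ∫⁻ y, M x y * ((T^[N] (k v)) y * w y) ∂ν) = fun x => ENNReal.ofReal (h x) := by
    funext x
    rw [hkv, hgeq]
    have h1 : ∀ y, M x y * (ENNReal.ofReal (g y) * w y) =
        ENNReal.ofReal (m x y) * ENNReal.ofReal (g y) * w y := fun y => by rw [hMeq]; ring
    simp_rw [h1]
    exact lintegral_ofReal_mul_ofReal_mul hw hwi hmm.of_uncurry_left hgm (hm0 x) hg0 (hmb x) hBg
  have hhm : Measurable h :=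
    (hmm.stronglyMeasurable.mul (hgm.stronglyMeasurable.comp_measurable measurable_snd)
      |>.integral_prod_right').measurable
  have hh0 : ∀ x, 0 ≤ h x := fun x => integral_nonneg fun y => mul_nonneg (hm0 x y) (hg0 y)
  have hBg0 : 0 ≤ Bg := (hg0 v).trans (hBg v)
  have hhb : ∀ x, h x ≤ CM * Bg * (ν.withDensity w).real univ := by
    intro x
    calc h x = ∫ y, m x y * g y ∂ν.withDensity w := rfl
      _ ≤ ∫ _y, CM * Bg ∂ν.withDensity w := by
          refine integral_mono_of_nonneg (Eventually.of_forall fun y => mul_nonneg (hm0 x y) (hg0 y))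
            (integrable_const _) (Eventually.of_forall fun y => ?_)
          exact mul_le_mul (hmb x y) (hBg y) (hg0 y) hCM
      _ = CM * Bg * (ν.withDensity w).real univ := by
          rw [integral_const, smul_eq_mul]; ring
  obtain ⟨-, -, hN0, hNeq⟩ := iterate_transfer_ofReal hw hwi hK hC hK0 hk hT hhm hh0 hhb N
  rw [hH, hNeq]
  exact ⟨rfl, hN0 u⟩

/-! ### Boundary-independence of the ratios, uniformly on compact sets of boundary spins -/

/-- **Transfer-operator ratios converge uniformly on compact sets of boundary spins.** Let `ν` be
σ-finite on the topological measurable space `S`, `w` a measurable one-site weight with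
`0 < ∫⁻ w dν < ∞`, `K` a jointly measurable, bounded, symmetric, strictly positive real kernel,
continuous in its first (boundary) variable, `k = ofReal ∘ K`, `T` the `ℝ≥0∞` transfer operator,
and `M, M₁` jointly measurable insertion kernels bounded by `ofReal C_M` with `M₁ > 0`. Then there
is `L ∈ ℝ` such that for every compact set `C` of spins and every `ε > 0` there is `N₀` with
`|(T^N[x ↦ ∫⁻ M(x,y)(T^N k(v,·))(y) w(y) dν](u) / T^N[x ↦ ∫⁻ M₁(x,y)(T^N k(v,·))(y) w(y) dν](u)).toReal - L| < ε`
for all `N ≥ N₀` and all boundary spins `u, v ∈ C` (Jentzsch / Kreĭn–Rutman spectral gap of the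
transfer operator on `L²(w dν)` and power iteration; the mechanism of uniqueness of the Gibbs
state of one-dimensional models with strictly positive Hilbert–Schmidt transfer kernels).
[cite: Georgii2011, Thm 10.25 and §11.1] -/
theorem exists_limit_iterate_transfer_ratio [TopologicalSpace S] [FirstCountableTopology S]
    [SFinite ν] (hw : Measurable w) (hwi : ∫⁻ y, w y ∂ν ≠ ∞) (hw0 : ν.withDensity w ≠ 0)
    (hK : StronglyMeasurable (uncurry K)) (hKc : ∀ y, Continuous fun u => K u y)
    (hC : ∀ x y, ‖K x y‖ ≤ C) (hsymm : ∀ x y, K x y = K y x) (hpos : ∀ x y, 0 < K x y)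
    (hk : ∀ x y, k x y = ENNReal.ofReal (K x y))
    (hT : ∀ f z, T f z = ∫⁻ y, k z y * f y * w y ∂ν)
    {M M₁ : S → S → ℝ≥0∞} {CM : ℝ} (hMm : Measurable (uncurry M)) (hM₁m : Measurable (uncurry M₁))
    (hCM : 0 ≤ CM) (hMb : ∀ x y, M x y ≤ ENNReal.ofReal CM) (hM₁b : ∀ x y, M₁ x y ≤ ENNReal.ofReal CM)
    (hM₁pos : ∀ x y, 0 < M₁ x y) :
    ∃ L : ℝ, ∀ Cpt : Set S, IsCompact Cpt → ∀ ε : ℝ, 0 < ε → ∃ N₀ : ℕ, ∀ N : ℕ, N₀ ≤ N →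
      ∀ u v : S, u ∈ Cpt → v ∈ Cpt →
        |((T^[N] fun x => ∫⁻ y, M x y * ((T^[N] (k v)) y * w y) ∂ν) u /
            (T^[N] fun x => ∫⁻ y, M₁ x y * ((T^[N] (k v)) y * w y) ∂ν) u).toReal - L| < ε := by
  haveI : IsFiniteMeasure (ν.withDensity w) := isFiniteMeasure_withDensity hwi
  have hK0 : ∀ x y, 0 ≤ K x y := fun x y => (hpos x y).le
  -- the real insertion kernels
  set m : S → S → ℝ := fun x y => (M x y).toReal with hm
  set m₁ : S → S → ℝ := fun x y => (M₁ x y).toReal with hm₁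
  have hmm : StronglyMeasurable (uncurry m) := hMm.ennreal_toReal.stronglyMeasurable
  have hm₁m : StronglyMeasurable (uncurry m₁) := hM₁m.ennreal_toReal.stronglyMeasurable
  have hmb : ∀ x y, ‖m x y‖ ≤ CM := fun x y => by
    rw [Real.norm_eq_abs, abs_of_nonneg ENNReal.toReal_nonneg]
    exact ENNReal.toReal_le_of_le_ofReal hCM (hMb x y)
  have hm₁b : ∀ x y, ‖m₁ x y‖ ≤ CM := fun x y => by
    rw [Real.norm_eq_abs, abs_of_nonneg ENNReal.toReal_nonneg]
    exact ENNReal.toReal_le_of_le_ofReal hCM (hM₁b x y)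
  have hm₁pos : ∀ x y, 0 < m₁ x y := fun x y =>
    ENNReal.toReal_pos (hM₁pos x y).ne' (ne_top_of_le_ne_top ENNReal.ofReal_ne_top (hM₁b x y))
  -- the analytic core
  obtain ⟨φ₀, L, hφi, hφ0, hφne, hlim⟩ := exists_kernelRatio_tendsto_uniformly
    (μ := ν.withDensity w) hK hC hsymm hpos hw0 hmm hmb hm₁m hm₁b hm₁pos
  refine ⟨L, fun Cpt hCpt ε hε => ?_⟩
  obtain ⟨δ, hδ, hδle⟩ := exists_pos_forall_le_integral_mul_kernel (ρ := ν.withDensity w) hKc hpos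
    (fun u => (hK.measurable.of_uncurry_left (x := u)).aestronglyMeasurable) hC hφi hφ0 hφne hCpt
  obtain ⟨N₀, hN₀⟩ := hlim δ hδ ε hε
  refine ⟨N₀, fun N hN u v hu hv => ?_⟩
  have key := hN₀ N hN u v (hδle u hu) (hδle v hv)
  obtain ⟨hnum, hnum0⟩ := iterate_transfer_insertion_eq_ofReal hw hwi hK hC hK0 hk hT hMm hCM hMb N u v
  obtain ⟨hden, hden0⟩ := iterate_transfer_insertion_eq_ofReal hw hwi hK hC hK0 hk hT hM₁m hCM hM₁b N u v
  rw [hnum, hden, ENNReal.toReal_div, ENNReal.toReal_ofReal hnum0, ENNReal.toReal_ofReal hden0]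
  exact key

end Literature.Probability.LatticeModels

end
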